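import Literature.Geometry.Riemannian.SchurLemma
import Literature.Geometry.Riemannian.EinsteinWeylZero
import Literature.Geometry.Riemannian.BonnetMyers
import Literature.Geometry.Riemannian.HopfRinowHeineBorel
import Literature.Geometry.Riemannian.ConstantCurvature
import HarnessLib

/-!
# Route EntropyRung · crux `ChangGurskyYang` · line `margerin-cone-hamilton-rails` — STUB 4e `stub_roundRecognition`
# (a complete connected Einstein conformally flat `4`-manifold with `R > 0` somewhere is a compact space form of curvature `k > 0`)

Stub `stub_roundRecognition` of the registered skeleton
`Cruxes/ChangGurskyYang/Lines/margerin-cone-hamilton-rails.lean` of crux stmt-SmoothPoincare4-10834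
(`Summit.SmoothPoincare4.SmoothPoincare4.Theses.EntropyRung.ChangGurskyYang`): the recognition of the
blow-up limit `(N, h)` of the pinched Ricci flow — a complete connected Riemannian `4`-manifold with
`Ric = (R/4) h`, `W = 0` and `R > 0` at one point — as a COMPACT space of constant sectional curvature
`k > 0`. A pure composition of theorems of the tree:

1. **Schur** (`exists_ricci_eq_const_smul_of_ricci_eq_smul`, O'Neill 1983, Ch. 3, Exercise 3.21;
   dimension `4 ≠ 2`): `Ric = c h` for a CONSTANT `c`;
2. `scalarCurvature_eq_of_ricci_eq` (Besse 1987, 1.118): `R ≡ 4c`, so `c = R(y₀)/4 > 0` at the given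
   point `y₀`;
3. **Besse 1.118** (`hasConstantSectionalCurvature_of_ricci_eq_of_weylFrame_eq_zero`): Einstein with
   `W = 0` in dimension `4` has constant sectional curvature `k := c/3 > 0`;
4. **Myers** (`edist_le_pi_div_sqrt_of_ricci_ge`, Lee 2018, Thm. 12.24; Myers 1941): `Ric(w, w) =
   c h(w, w) = (4 - 1) k h(w, w)` and the Levi-Civita connection is complete, so `d(y₀, q) ≤ π/√k`
   for every `q` (the `C¹`/`C^∞` regularity instances of the smooth Levi-Civita connection come from
   `isLocallyContMDiff_leviCivita_holds`, exactly as in `edist_le_pi_div_sqrt_of_ricci_ge_of_compactSpace`);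
5. **Hopf–Rinow–Heine–Borel** (`isCompact_setOf_edist_le`, O'Neill 1983, Ch. 5, Thm. 21): the closed
   ball `{q | d(y₀, q) ≤ π/√k}` is compact, and by 4 it is all of `N`.

References: A. L. Besse, *Einstein Manifolds* (1987), 1.118 [Besse1987]; J. M. Lee, *Introduction to
Riemannian Manifolds*, 2nd ed. (2018), Thm. 12.24 [LeeRiemannianManifolds2018]; S. B. Myers, Duke
Math. J. 8 (1941), Thm. 1 [Myers1941]; B. O'Neill, *Semi-Riemannian geometry* (1983), Ch. 3,
Exercise 3.21 and Ch. 5, Thm. 21 [ONeill1983].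
-/

noncomputable section

-- every `Summit.SmoothPoincare4.SmoothPoincare4.…` name repeats the summit = sub-problem segment (D-0017 layout)
set_option linter.dupNamespace false

open Set Function Module
open scoped Manifold ContDiff Topology ENNReal NNReal

namespace Summit.SmoothPoincare4.SmoothPoincare4.Theorems.MargerinRails

open Literature.Geometry.Riemannian Literature.Geometry.Lorentzian
  Literature.Geometry.Lorentzian.PseudoRiemannianMetric

/-- **STUB 4e — ROUND RECOGNITION: a complete connected Einstein `4`-manifold with `W = 0` and `R > 0`
somewhere is a COMPACT space form of curvature `k > 0`.** Schur (`Ric = (R/4) h` on a connected manifold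
of dimension `4 ≠ 2` forces `Ric = c h` with `c` constant, `exists_ricci_eq_const_smul_of_ricci_eq_smul`);
`R ≡ 4c` (`scalarCurvature_eq_of_ricci_eq`), so `c > 0` at the point where `R > 0`; Einstein + `W = 0`
in dimension `4` is constant sectional curvature `k = c/3` (Besse 1987, 1.118,
`hasConstantSectionalCurvature_of_ricci_eq_of_weylFrame_eq_zero`); `Ric(w, w) = 3k h(w, w)` over the
complete Levi-Civita connection gives `d(y₀, q) ≤ π/√k` (Myers, `edist_le_pi_div_sqrt_of_ricci_ge`,
with the `ContMDiffCovariantDerivative` instances from `isLocallyContMDiff_leviCivita_holds`), so `N`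
is the closed ball `{q | d(y₀, q) ≤ π/√k}`, compact by Hopf–Rinow–Heine–Borel
(`isCompact_setOf_edist_le`). [cite: Besse1987, 1.118] [cite: LeeRiemannianManifolds2018, Thm. 12.24]
[cite: Myers1941, Thm. 1] [cite: ONeill1983, Ch. 5, Thm. 21] -/
theorem stub_roundRecognition :
    ∀ (N : Type) [TopologicalSpace N] [T2Space N] [SecondCountableTopology N]
      [ChartedSpace (EuclideanSpace ℝ (Fin 4)) N] [IsManifold (𝓡 4) ∞ N] [ConnectedSpace N]
      (h : PseudoRiemannianMetric (𝓡 4) ∞ (EuclideanSpace ℝ (Fin 4)) (TangentSpace (𝓡 4) : N → Type _))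
      [h.HasLeviCivita], h.IsRiemannian → IsGeodesicallyComplete h.leviCivita →
      (∀ (y : N) (e : Fin 4 → TangentSpace (𝓡 4) y), h.IsOrthonormalFrame y e →
        ∀ i j k l, h.weylFrame y e i j k l = 0) →
      (∀ (y : N) (X Y : TangentSpace (𝓡 4) y),
        h.ricci y X Y = h.scalarCurvature y / 4 * h.val y X Y) →
      (∃ y : N, 0 < h.scalarCurvature y) →
      CompactSpace N ∧ ∃ k : ℝ, 0 < k ∧ h.HasConstantSectionalCurvature k := by
  intro N _ _ _ _ _ _ h _ hh hc hW hRic hpos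
  obtain ⟨y₀, hy₀⟩ := hpos
  -- (1) Schur: `Ric = c h` with a constant `c`
  have h4 : finrank ℝ (EuclideanSpace ℝ (Fin 4)) = 4 := finrank_euclideanSpace_fin
  have hn2 : finrank ℝ (EuclideanSpace ℝ (Fin 4)) ≠ 2 := by rw [h4]; decide
  obtain ⟨c, hc'⟩ := exists_ricci_eq_const_smul_of_ricci_eq_smul h hn2
    (φ := fun y ↦ h.scalarCurvature y / 4) hRic
  -- (2) `R ≡ 4c`, so `c > 0`
  have hS : ∀ y, h.scalarCurvature y = 4 * c := fun y ↦ by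
    have h' := scalarCurvature_eq_of_ricci_eq h hh h4 hc' y
    exact_mod_cast h'
  have hcpos : 0 < c := by
    have h' := hS y₀
    rw [h'] at hy₀
    linarith
  -- (3) Besse 1.118: constant sectional curvature `c/3`
  have hK : h.HasConstantSectionalCurvature (c / 3) :=
    hasConstantSectionalCurvature_of_ricci_eq_of_weylFrame_eq_zero h
      (WithTop.coe_le_coe.mpr le_top) hh h4 hc' hW
  have hkpos : 0 < c / 3 := by positivity
  refine ⟨?_, c / 3, hkpos, hK⟩
  -- (4) Myers: `d(y₀, q) ≤ π/√k` for all `q`, over the complete smooth Levi-Civita connection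
  have hk1 : ((1 : ℕ∞) : ℕ∞ω) + 1 ≤ (∞ : ℕ∞ω) := by
    rw [show ((1 : ℕ∞) : ℕ∞ω) + 1 = 2 by norm_num]
    exact WithTop.coe_le_coe.2 le_top
  haveI : CovariantDerivative.ContMDiffCovariantDerivative h.leviCivita 1 :=
    ⟨h.isLocallyContMDiff_leviCivita_holds 1 hk1 univ isOpen_univ⟩
  haveI : CovariantDerivative.ContMDiffCovariantDerivative h.leviCivita ∞ :=
    ⟨h.isLocallyContMDiff_leviCivita_holds ⊤ (le_of_eq rfl) univ isOpen_univ⟩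
  have hdim : 2 ≤ finrank ℝ (EuclideanSpace ℝ (Fin 4)) := by rw [h4]; norm_num
  have hRic' : ∀ (x : N) (w : TangentSpace (𝓡 4) x),
      ((finrank ℝ (EuclideanSpace ℝ (Fin 4)) : ℝ) - 1) * (c / 3) * h.val x w w ≤
        h.leviCivita.ricci x w w := by
    intro x w
    rw [← ricci_apply, hc' x w w, h4]
    apply le_of_eq
    push_cast
    ring
  have hdist : ∀ q : N, h.edist hh y₀ q ≤ ENNReal.ofReal (Real.pi / Real.sqrt (c / 3)) :=
    fun q ↦ edist_le_pi_div_sqrt_of_ricci_ge h hh hdim hc hkpos hRic' y₀ q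
  -- (5) Hopf–Rinow–Heine–Borel: the closed ball of radius `π/√k` about `y₀` is compact, and is `N`
  have hcpt : IsCompact {q | h.edist hh y₀ q ≤ (Real.toNNReal (Real.pi / Real.sqrt (c / 3)) : ℝ≥0)} :=
    isCompact_setOf_edist_le h le_rfl hh hc y₀ _
  have huniv : {q | h.edist hh y₀ q ≤ (Real.toNNReal (Real.pi / Real.sqrt (c / 3)) : ℝ≥0)} = univ :=
    eq_univ_of_forall fun q ↦ hdist q
  rw [huniv] at hcpt
  exact ⟨hcpt⟩

end Summit.SmoothPoincare4.SmoothPoincare4.Theorems.MargerinRails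

end
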